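import Summits.ValiantsHypothesis.ValiantsHypothesis.Theorems.BarrierLeverChowBenchmarkPairsKernelPeelLead
import Summits.ValiantsHypothesis.ValiantsHypothesis.Theorems.BarrierLeverPartitionMinorsMooreBenchPeel

/-!
# Route BarrierLever — item 22038 `ChowBenchmarkPairs`, line `moore-peel`: the KERNEL-WEIGHTED hierarchical
# Moore peel, IV — THEOREM A^κ: `(κ without zeros) → (∀ i ≤ h, det G^κ_i ≠ 0) →` the stage-1 weighted rows are
# linearly independent

Helper file (`--supports stmt-ValiantsHypothesis-22038`; cell valiant-natproofs, rung V4, 𝒟-side benchmark of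
record, line `moore_peel`, card v12 (E)(ii); seat val-np-p4 gen 26).  Closes NO item; definition-free.  The
weighted verbatim analogue of `…PartitionMinorsMooreBenchPeel` (planner p1 g18's Theorem A), for an arbitrary
weight sequence `κ : ℕ → ℕ` without zeros (`κ = k!`: segment means; `κ = 1`: midpoint evaluations, file
`…MidpointPoised`; `κ(k) = α^{(k)}`: Dirichlet(α,α) segment means).

* `kpeel_step` — ONE STAGE: independence at stage `(i+1, n)` and `det G^κ_i ≠ 0` give independence at stage
  `(i, n+1)` (substitution `Y_n ↦ X` along an injective algebra map, then `…KernelPeelStage` and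
  `…KernelPeelLead`).
* `linearIndependent_kstageRows_terminal`, `linearIndependent_kstageRows` — the induction over the stages.
* **`linearIndependent_krow_stageOne` (THEOREM A^κ)** — if `κ` has no zero and `det G^κ_i ≠ 0` for `1 ≤ i ≤ h`,
  the `c_{h+1}` stage-1 rows `e_0`, `(∅,{b})`, `(∅,{b,b'})` on the first `c_{h+1}` codes are linearly
  independent over `MvPolynomial (Fin h) ℂ` (symbolic Moore nodes).
* Consistency: with `κ = Nat.factorial`, `krow_factorial` / `kpeelMatrix_factorial` turn THEOREM A^κ into the
  hypothesis of `mcBenchPairsAt_of_linearIndependent`, i.e. Theorem A of `…MooreBenchPeel` (not restated).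

WHAT THIS IS NOT: no stub of line `moore_peel` is closed; nothing is claimed about the segment-mean benchmark
`stub_segmentMeanValue` (factorial weights, `det G_183 = 0`); nothing on crux stmt-ValiantsHypothesis-14610 or on
`VP` versus `VNP`.
-/

set_option linter.dupNamespace false

namespace Summit.ValiantsHypothesis.ValiantsHypothesis.Theorems.BarrierLever.MoorePeel

open Polynomial Finset
/-! ## 5. The peel step, all stages, and THEOREM A^κ -/

/-- **THE KERNEL-WEIGHTED PEEL STEP.**  Let `i + n = h`, `1 ≤ i`, `κ` without zeros.  If the rows alive
at stage `(i+1, n)` are linearly independent over `MvPolynomial (Fin h) ℂ` and `det G^κ_i ≠ 0`, then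
the rows alive at stage `(i, n+1)` are linearly independent. -/
theorem kpeel_step (κ : ℕ → ℕ) (hκ : ∀ k, κ k ≠ 0) (h i n : ℕ) (hin : i + n = h) (hi : 1 ≤ i)
    (hG : (kpeelMatrix κ i).det ≠ 0)
    (IH : LinearIndependent (MvPolynomial (Fin h) ℂ)
      (fun y : ↥(stageRows (i + 1) n) => krow κ (windowStart (h + 1)) (nodeY h) (y : RowLabel))) :
    LinearIndependent (MvPolynomial (Fin h) ℂ)
      (fun x : ↥(stageRows i (n + 1)) => krow κ (windowStart (h + 1)) (nodeY h) (x : RowLabel)) := by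
  classical
  have hn : n < h := by omega
  -- the substitution `Y_n ↦ X`, an injective ring map `A → A[X]`
  set σ : MvPolynomial (Fin h) ℂ →ₐ[ℂ] Polynomial (MvPolynomial (Fin h) ℂ) :=
    MvPolynomial.aeval fun v : Fin h =>
      if (v : ℕ) = n then (Polynomial.X : Polynomial (MvPolynomial (Fin h) ℂ))
      else Polynomial.C (MvPolynomial.X v) with hσ
  have hσX : ∀ v : Fin h, σ (MvPolynomial.X v) =
      if (v : ℕ) = n then Polynomial.X else Polynomial.C (MvPolynomial.X v) := fun v => by
    rw [hσ, MvPolynomial.aeval_X]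
  have hσinj : Function.Injective σ := by
    set τ : Polynomial (MvPolynomial (Fin h) ℂ) →ₐ[MvPolynomial (Fin h) ℂ] MvPolynomial (Fin h) ℂ :=
      Polynomial.aeval (MvPolynomial.X ⟨n, hn⟩) with hτ
    have hcomp : (τ.restrictScalars ℂ).comp σ = AlgHom.id ℂ _ := by
      refine MvPolynomial.algHom_ext fun v => ?_
      rw [AlgHom.comp_apply, AlgHom.restrictScalars_apply, hσX, AlgHom.id_apply]
      split_ifs with hv
      · rw [hτ, Polynomial.aeval_X]
        congr 1
        exact Fin.ext hv.symm
      · rw [hτ, Polynomial.aeval_C]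
        rfl
    intro p q e
    have := congrArg (τ.restrictScalars ℂ) e
    rwa [← AlgHom.comp_apply, ← AlgHom.comp_apply, hcomp, AlgHom.id_apply, AlgHom.id_apply] at this
  -- the node table after substitution
  obtain ⟨Z, hZn, hZne, hσY⟩ : ∃ Z : ℕ → Polynomial (MvPolynomial (Fin h) ℂ),
      Z n = Polynomial.X ∧ (∀ b, b ≠ n → Z b = Polynomial.C (nodeY h b)) ∧
      ∀ b, σ (nodeY h b) = Z b := by
    refine ⟨fun b => if b = n then Polynomial.X else Polynomial.C (nodeY h b), by simp,
      fun b hb => by simp [hb], fun b => ?_⟩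
    by_cases hb : b < h
    · rw [nodeY, dif_pos hb, hσX]
      simp only [nodeY, dif_pos hb]
    · have hbn : b ≠ n := fun e => hb (e ▸ hn)
      simp only [nodeY, dif_neg hb, map_zero, if_neg hbn]
  have hZlt : ∀ b, b < n → Z b = Polynomial.C (nodeY h b) := fun b hb => hZne b (ne_of_lt hb)
  -- transfer along `σ`: it suffices to treat the rows over `A[X]` with node table `Z`
  apply linearIndependent_of_map_ringHom σ.toRingHom hσinj
  have hV0 : (fun (x : ↥(stageRows i (n + 1))) (c : Fin (windowStart (h + 1))) =>
      σ.toRingHom (krow κ (windowStart (h + 1)) (nodeY h) (x : RowLabel) c)) =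
      fun (x : ↥(stageRows i (n + 1))) c => krow κ (windowStart (h + 1)) Z (x : RowLabel) c := by
    funext x c
    rw [map_krow]
    exact congrFun (congrArg (krow κ (windowStart (h + 1)) · (x : RowLabel)) (funext hσY)) c
  rw [hV0]
  -- stage reduction I and II
  exact linearIndependent_krow_of_reduced κ (windowStart (h + 1)) i n (nodeY h) Z hZn hZlt
    (linearIndependent_kreducedRow κ hκ h i n (windowStart (h + 1)) hG IH)

/-- The terminal stage `(h+1, 0)`: all `c_{h+1}` monomial rows, i.e. the unit vectors. -/
theorem linearIndependent_kstageRows_terminal (κ : ℕ → ℕ) (h : ℕ) :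
    LinearIndependent (MvPolynomial (Fin h) ℂ)
      (fun x : ↥(stageRows (h + 1) 0) => krow κ (windowStart (h + 1)) (nodeY h) (x : RowLabel)) := by
  classical
  have hval : ∀ x : ↥(stageRows (h + 1) 0), ∃ m : Fin (windowStart (h + 1)),
      (x : RowLabel) = Sum.inl (m : ℕ) := by
    rintro ⟨x, hx⟩
    rcases x with m | ⟨j, b⟩ | ⟨b, b'⟩
    · exact ⟨⟨m, inl_mem_stageRows.mp hx⟩, rfl⟩
    · exact absurd (inr_inl_mem_stageRows.mp hx).2 (Nat.not_lt_zero _)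
    · exact absurd (inr_inr_mem_stageRows.mp hx).2 (Nat.not_lt_zero _)
  choose e he using hval
  have heinj : Function.Injective e := fun x y exy => Subtype.ext (by rw [he x, he y, exy])
  have hfam : (fun x : ↥(stageRows (h + 1) 0) =>
      krow κ (windowStart (h + 1)) (nodeY h) (x : RowLabel)) =
      fun x col => if col = e x then (1 : MvPolynomial (Fin h) ℂ) else 0 := by
    funext x col
    rw [he x]
    simp only [krow]
    by_cases hc : col = e x
    · rw [if_pos hc, if_pos (congrArg Fin.val hc)]
    · rw [if_neg hc, if_neg (fun e' => hc (Fin.ext e'))]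
  rw [hfam]
  exact linearIndependent_unitVec e heinj

/-- **All stages.**  For `i + n = h + 1`, `1 ≤ i`, `κ` without zeros: if `det G^κ_{i'} ≠ 0` for all
`i ≤ i' ≤ h`, then the rows alive at stage `(i, n)` are linearly independent. -/
theorem linearIndependent_kstageRows (κ : ℕ → ℕ) (hκ : ∀ k, κ k ≠ 0) (h : ℕ) :
    ∀ n i : ℕ, i + n = h + 1 → 1 ≤ i → (∀ i', i ≤ i' → i' ≤ h → (kpeelMatrix κ i').det ≠ 0) →
      LinearIndependent (MvPolynomial (Fin h) ℂ)
        (fun x : ↥(stageRows i n) => krow κ (windowStart (h + 1)) (nodeY h) (x : RowLabel)) := by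
  intro n
  induction n with
  | zero =>
    intro i hin _ _
    rw [add_zero] at hin
    subst hin
    exact linearIndependent_kstageRows_terminal κ h
  | succ n ih =>
    intro i hin hi hdet
    exact kpeel_step κ hκ h i n (by omega) hi (hdet i le_rfl (by omega))
      (ih (i + 1) (by omega) (by omega) fun i' hi' hi'h => hdet i' (by omega) hi'h)

/-- **THEOREM A^κ (the kernel-weighted hierarchical Moore peel).**  Let `κ : ℕ → ℕ` have no zero and let
the stage matrices `G^κ_1, …, G^κ_h` all have nonzero determinant.  Then the `c_{h+1}` stage-1 rows —
`e_0`, the one-point rows `(∅,{b}) = (κ|T| · Y_b^{bin T})_T` and the pair rows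
`(∅,{b,b'}) = (Σ_{d ⊆ T} κ|T∖d| Y_b^{bin(T∖d)} κ|d| Y_{b'}^{bin d})_T` (`b < b' < h`) on the first
`c_{h+1}` binary codes `T` — are linearly independent over `MvPolynomial (Fin h) ℂ` (symbolic nodes). -/
theorem linearIndependent_krow_stageOne (κ : ℕ → ℕ) (hκ : ∀ k, κ k ≠ 0) (h : ℕ)
    (hdet : ∀ i : ℕ, 1 ≤ i → i ≤ h → (kpeelMatrix κ i).det ≠ 0) :
    LinearIndependent (MvPolynomial (Fin h) ℂ)
      (fun x : ↥(stageRows 1 h) => krow κ (windowStart (h + 1)) (nodeY h) (x : RowLabel)) :=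
  linearIndependent_kstageRows κ hκ h h 1 (by omega) le_rfl fun i' hi' hi'h => hdet i' hi' hi'h

end Summit.ValiantsHypothesis.ValiantsHypothesis.Theorems.BarrierLever.MoorePeel
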